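import Summits.BirchSwinnertonDyer.BirchSwinnertonDyer.Theorems.BiquadraticEisensteinDescentEisensteinDivisibilityCMInertBadFlatAtOneAbsIrrTools
import Literature.NumberTheory.Automorphic.BCDTModularityModPProofs
import Literature.NumberTheory.EllipticCurves.HasseWeilGoodReductionProofs
import Literature.NumberTheory.EllipticCurves.HeegnerPoints
import Literature.NumberTheory.GaloisRepresentations.IntegralGaloisActionProofs
import Literature.NumberTheory.NumberFields.QuadraticRamifiedLocalModel
import Literature.NumberTheory.QuadraticFields.KroneckerSplitting
import Summits.BirchSwinnertonDyer.Rank1Residual.Additive.CyclotomicPrimeReduction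
import Summits.BirchSwinnertonDyer.Rank1Residual.X11b.AnticyclotomicEmbedding
import Summits.BirchSwinnertonDyer.Rank1Residual.X12.CMInertTrace
import Summits.BirchSwinnertonDyer.BirchSwinnertonDyer.Theorems.PlecticLegsArtinBaseChangePlaces
import HarnessLib

set_option linter.dupNamespace false -- `Summit.BirchSwinnertonDyer.BirchSwinnertonDyer.Theorems.…` (summit = sub)
set_option autoImplicit false

/-!
# Crux (E♭°) `EisensteinDivisibilityCMInertBadFlatAtOne` (stmt-BirchSwinnertonDyer-20452), line `birth`:
# the binder (Irr) is a THEOREM — `E[p]|_{Γ_{K′}}` is absolutely irreducible for a CM curve `E/ℚ`, a prime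
# `p ≥ 5` inert in the CM field with `p ∣ N_E`, and ANY imaginary quadratic `K′` satisfying the Heegner
# hypothesis for `N_E`

Route `BiquadraticEisensteinDescent` (cell `pub/bsd-wall`, lead-prover seat `bsd-wall-bed-p1`, g3). The landed
helpers of line `birth` (p519061 `…FlatAtOneStubE2`, p520683 `…FlatAtOneOfFacts`) carry hypothesis (2) of Hsieh's
Theorem B (Doc. Math. 19 (2014) p. 712) as an undischarged binder

  (Irr) `∀ ρ : ModPGaloisRep K′ (ZMod p) 2, (W.baseChange K′).IsTorsionGaloisRep p ρ → FramedRep.IsAbsolutelyIrreducible ρ`,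

and the route planner's rev-9 draft files it as the support item `AbsIrrModPBaseChangeCMInert` (HOME
bsd-wall-cm/rev9/AbsIrr9.sig). THIS FILE PROVES IT, with exactly the planner's binders (`absIrrModPBaseChangeCMInert`,
§4), by a two-Frobenius criterion inside `Γ_{K′}` (tools in `…FlatAtOneAbsIrrTools`: §1 the criterion, §2 the
Dirichlet primes) — no complex-multiplication structure theory of `E[p]`, no image theorem, no local analysis at `p`:

* §3 `exists_charpoly_eq_of_split` — for `ℓ ≠ p` of good reduction SPLIT in the quadratic `K′`, some `σ ∈ Γ_{K′}`
  (a Frobenius at a degree-one prime `w ∣ ℓ`) has `charpoly ρ̄(σ) = X² − ā_ℓ(E) X + ℓ̄` on any framing `ρ̄` of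
  `E_{K′}[p]` (Diamond–Shurman Thm. 9.4.1 mod `p` over `K′`, tree `IsTorsionGaloisRep.charpoly_eq_of_isArithFrobAt`,
  with `a_w(E_{K′}) = a_ℓ(E)`, `#k_w = ℓ` at a degree-one prime, tree
  `Additive.frobeniusTraceAt_baseChange_eq_frobeniusTrace_prime`).
* §4 `absIrrModPBaseChangeCMInert` — the assembly. With `d = d_{K_CM}` (`cmFieldDiscrOfJ`) and `d′ = d_{K′}`:
  `(d/p) = −1` (`CMInert`), `(d′/p) = +1` (`p ∣ N_E` splits in `K′`: Heegner; decomposition law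
  `Quadratic.ncard_primesOver_eq_two_iff_legendreSym`), so §2 gives good primes `ℓ₃ ≡ −1`, `ℓ₁ ≡ −x (mod p)` (`x` a
  non-residue) inert in `K_CM` and split in `K′`; Deuring (`X12.frobeniusTrace_eq_zero_of_legendreSym_cmFieldDiscr_eq_neg_one`
  on the `ℚ`-isogenous curve with CM by the maximal order of the same field,
  `X12.exists_isGloballyMinimal_isIsogenous_maximal_cmFieldDiscr_eq`, and isogeny invariance
  `frobeniusTrace_eq_of_isIsogenous`) gives `a_{ℓ₃} = a_{ℓ₁} = 0`; by §3 the Frobenius elements of `Γ_{K′}` above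
  `ℓ₃`, `ℓ₁` act with characteristic polynomials `X² − 1` and `X² − x`; §1 (`isAbsolutelyIrreducible_of_charpoly`).

Why (Irr) need not be carried as a hypothesis: for a CM curve at an inert `p ≥ 5` the image of `Γ_ℚ` on `E[p]` is
the normaliser of a non-split Cartan subgroup, and `Γ_{K′}` (`K′ ≠ K_CM`, as `p` splits in `K′`) does not land in
the Cartan; the two Frobenius elements exhibit this without naming the Cartan.

THEOREMS ONLY (no definition, no named fact, no `sorry`); every input is a PROVED theorem of the tree
(`trace_/det_galoisRepTate_frobenius_of_hasGoodReductionAt_holds`, `exists_isArithFrobAt_of_mem_primesAbove_holds`,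
`isIsogenous_quadraticTwist_cmFieldDiscr_holds` inside `X12.CMInertTrace`), so the result is UNCONDITIONAL. Supports,
does not close, stmt-BirchSwinnertonDyer-20452: it discharges the (Irr) binder of p519061 / p520683.

References: [DiamondShurman2005] Thm. 9.4.1; [SilvermanAEC2009] C.21 Remark 21.3, V.2.3.1, VII.1.3; [Lang1987]
Ch. 13 §4 Thm. 12 (Deuring); [Hsieh2014] Thm. B hypothesis (2) (Doc. Math. 19 p. 712); [Mazur1978] §6 Prop. 6.3 (1)
(the one-Frobenius irreducibility criterion over `ℚ`, of which this is the two-Frobenius version over `K′`);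
[DarmonDiamondTaylor1995] p. 87; [Cox2013] Lemma 1.14.
-/

noncomputable section

open scoped Matrix NumberField NumberTheorySymbols
open Polynomial Module IsDedekindDomain WeierstrassCurve NumberField
  Literature.NumberTheory.EllipticCurves Literature.NumberTheory.EllipticCurves.Rank1Residual
  Literature.NumberTheory.GaloisRepresentations
  Literature.NumberTheory.QuadraticFields.Quadratic
  Summit.BirchSwinnertonDyer.Rank1Residual
  Summit.BirchSwinnertonDyer.BirchSwinnertonDyer.Theorems.BiquadraticEisensteinDescentEisensteinDivisibilityCMInertBadFlatAtOneAbsIrrTools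

namespace Summit.BirchSwinnertonDyer.BirchSwinnertonDyer.Theorems.BiquadraticEisensteinDescentEisensteinDivisibilityCMInertBadFlatAtOneAbsIrr

/-! ### §3 The characteristic polynomial of a Frobenius of `K′` at a split prime on `E[p]` -/

/-- Two distinct rational primes do not lie in a common prime of `𝓞 K`. [folklore] -/
theorem natCast_notMem_of_natCast_mem {K : Type} [Field K] [NumberField K]
    (w : HeightOneSpectrum (𝓞 K)) {ℓ p : ℕ} (hℓ : ℓ.Prime) (hp : p.Prime) (hne : ℓ ≠ p)
    (hℓw : ((ℓ : ℕ) : 𝓞 K) ∈ w.asIdeal) : ((p : ℕ) : 𝓞 K) ∉ w.asIdeal := by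
  intro hpw
  apply w.isPrime.ne_top
  rw [Ideal.eq_top_iff_one]
  have hcop : IsCoprime (ℓ : ℤ) (p : ℤ) :=
    Nat.isCoprime_iff_coprime.mpr ((Nat.coprime_primes hℓ hp).mpr hne)
  obtain ⟨a, b, hab⟩ := hcop
  have h : ((a * ℓ + b * p : ℤ) : 𝓞 K) = 1 := by rw [hab]; push_cast; rfl
  rw [← h]
  push_cast
  exact w.asIdeal.add_mem (w.asIdeal.mul_mem_left _ hℓw) (w.asIdeal.mul_mem_left _ hpw)

/-- **Characteristic polynomial of a Frobenius of `K′` at a split prime on `E[p]`.** Let `W/ℚ` be globally minimal,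
`p` a prime, `K′` a quadratic field, `ρ̄` ANY framing of `E_{K′}[p]` (`(W.baseChange K′).IsTorsionGaloisRep p ρ̄`), and
`ℓ ≠ p` a prime with `ℓ ∤ Δ_min(W)` (good reduction) which SPLITS in `K′` (two primes above `ℓ`). Then some `σ ∈ Γ_{K′}`
— an arithmetic Frobenius at a prime of `K̄′` above a degree-one prime `w ∣ ℓ` of `K′`
(`X11b.exists_degreeOnePrime_of_splitsIn`, `exists_isArithFrobAt_of_mem_primesAbove_holds`) — has
`charpoly ρ̄(σ) = X² − ā_ℓ(W) X + ℓ̄ ∈ 𝔽_p[X]`: Diamond–Shurman Thm. 9.4.1 / Silverman C.21.3 read mod `p` over `K′`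
(`IsTorsionGaloisRep.charpoly_eq_of_isArithFrobAt`, with the tree's theorems
`trace_/det_galoisRepTate_frobenius_of_hasGoodReductionAt_holds`), where `W_{K′}` has good reduction at `w` with
`a_w(W_{K′}) = a_ℓ(W)` and `#k_w = N(w) = ℓ` because `f(w|ℓ) = 1`
(`Additive.frobeniusTraceAt_baseChange_eq_frobeniusTrace_prime`, `absNorm_eq_of_inertiaDeg_eq_one`).
[cite: DiamondShurman2005, Thm. 9.4.1 (proof)] [cite: SilvermanAEC2009, C.21 Remark 21.3 and Thm. V.2.3.1] -/
theorem exists_charpoly_eq_of_split (W : WeierstrassCurve ℚ) [W.IsElliptic] [W.IsGloballyMinimal]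
    (p : ℕ) [Fact p.Prime] (K : Type) [Field K] [NumberField K] (hK2 : Module.finrank ℚ K = 2)
    {ρ : ModPGaloisRep K (ZMod p) 2} (hρ : (W.baseChange K).IsTorsionGaloisRep p ρ)
    {ℓ : ℕ} (hℓ : ℓ.Prime) (hℓp : ℓ ≠ p) (hℓΔ : ¬ (ℓ : ℤ) ∣ minimalDiscriminantInt W)
    (hsplit : ((Ideal.span {(ℓ : ℤ)}).primesOver (𝓞 K)).ncard = 2) :
    ∃ σ : Field.absoluteGaloisGroup K,
      ((ρ σ : GL (Fin 2) (ZMod p)) : Matrix (Fin 2) (Fin 2) (ZMod p)).charpoly =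
        X ^ 2 - C ((W.frobeniusTrace ℓ : ℤ) : ZMod p) * X + C ((ℓ : ℕ) : ZMod p) := by
  haveI : Fact ℓ.Prime := ⟨hℓ⟩
  haveI hEK : (W.baseChange K).IsElliptic := by rw [baseChange]; infer_instance
  -- a degree-one prime `w ∣ ℓ` of `K`
  obtain ⟨w, hw, -, hf⟩ := X11b.exists_degreeOnePrime_of_splitsIn K ℓ hK2 hsplit
  haveI := w.isMaximal
  have hf' : w.asIdeal.inertiaDeg ℤ = 1 := by
    rw [← Summit.BirchSwinnertonDyer.BirchSwinnertonDyer.Theorems.inertiaDeg_ringOfIntegersRat_eq]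
    exact hf
  have hN : Ideal.absNorm w.asIdeal = ℓ :=
    Literature.NumberTheory.NumberFields.absNorm_eq_of_inertiaDeg_eq_one w hℓ hw hf'
  -- good reduction of `W_K` at `w`, `a_w(W_K) = a_ℓ(W)`, `#k_w = ℓ`
  obtain ⟨-, hgood⟩ := Additive.isMinimalAt_and_hasGoodReductionAt_baseChange_of_mem W (K := K) hℓΔ w hw
  have htr : (W.baseChange K).frobeniusTraceAt w = W.frobeniusTrace ℓ :=
    Additive.frobeniusTraceAt_baseChange_eq_frobeniusTrace_prime W ℓ w hw hN hℓΔ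
  have hcard : Nat.card (IsLocalRing.ResidueField (w.adicCompletionIntegers K)) = ℓ :=
    Additive.natCard_residueField_adicCompletionIntegers_eq_of_absNorm w hN
  -- `p ∉ w`
  have hpw : ((p : ℕ) : 𝓞 K) ∉ w.asIdeal := natCast_notMem_of_natCast_mem w hℓ Fact.out hℓp hw
  -- an arithmetic Frobenius at a prime of `K̄` above `w`
  obtain ⟨𝔓, h𝔓⟩ := w.primesAbove_nonempty
  obtain ⟨σ, hσ⟩ := HeightOneSpectrum.exists_isArithFrobAt_of_mem_primesAbove_holds (v := w) h𝔓
  refine ⟨σ, ?_⟩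
  rw [IsTorsionGaloisRep.charpoly_eq_of_isArithFrobAt
    ((W.baseChange K).trace_galoisRepTate_frobenius_of_hasGoodReductionAt_holds p)
    ((W.baseChange K).det_galoisRepTate_frobenius_of_hasGoodReductionAt_holds p) hρ hpw hgood h𝔓 hσ,
    htr, hcard]

/-! ### §4 (Irr) for CM curves at an inert bad prime `p ≥ 5` over every Heegner field -/

/-- The discriminant of a quadratic field is `≡ 0` or `1 (mod 4)` (Stickelberger's congruence; here from the
tree's integral basis `(1, ω)` with `ω² = m + tω`, `d_K = t² + 4m`, `Quadratic.discr_eq_sq_add_four_mul`). [folklore] -/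
theorem discr_emod_four_of_finrank_eq_two {K : Type} [Field K] [NumberField K]
    (h2 : Module.finrank ℚ K = 2) :
    NumberField.discr K % 4 = 0 ∨ NumberField.discr K % 4 = 1 := by
  obtain ⟨b, hb⟩ := exists_basis_zero_eq_one h2
  rw [discr_eq_sq_add_four_mul b hb]
  generalize b.repr (b 1 * b 1) 1 = t
  generalize b.repr (b 1 * b 1) 0 = m
  rcases Int.even_or_odd t with ⟨k, rfl⟩ | ⟨k, rfl⟩
  · left
    have : (k + k) ^ 2 + 4 * m = 4 * (k * k + m) := by ring
    omega
  · right
    have : (2 * k + 1) ^ 2 + 4 * m = 4 * (k * k + k + m) + 1 := by ring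
    omega

/-- The nine maximal-order CM field discriminants `−3, −4, −7, −8, −11, −19, −43, −67, −163` are `≡ 0` or
`1 (mod 4)` (tree `cmFieldDiscr_mem`). [cite: SilvermanATAEC1994, App. A §3 (first table)] -/
theorem cmFieldDiscr_emod_four {j : ℚ} (hj : j ∈ maximalCMJInvariants) :
    cmFieldDiscr j % 4 = 0 ∨ cmFieldDiscr j % 4 = 1 := by
  have h := cmFieldDiscr_mem hj
  simp only [Finset.mem_insert, Finset.mem_singleton] at h
  rcases h with h | h | h | h | h | h | h | h | h <;> rw [h] <;> decide

/-- **(Irr) — the support item `AbsIrrModPBaseChangeCMInert` of the route planner's rev-9 draft, PROVED with its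
binders verbatim.** Let `W/ℚ` be a globally minimal CM elliptic curve, `p ≥ 5` a prime INERT in the CM field
(`CMInert W p`) at which `W` has BAD reduction, and `K′` an imaginary quadratic field satisfying the Heegner hypothesis
for `N_W`. Then EVERY framing `ρ̄ : Γ_{K′} →ₜ* GL₂(𝔽_p)` of `E_{K′}[p]` is absolutely irreducible — hypothesis (2) of
Hsieh, Doc. Math. 19 (2014) Thm. B for the pair `(E, K′)`.

Proof (two Frobenius elements of `Γ_{K′}`). Put `d = d_{K_CM}` (`cmFieldDiscrOfJ W.j`) and `d′ = d_{K′}`. `CMInert`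
says `p ∤ d` and `(d/p) = −1`; `p ∣ N_W` (bad reduction, `dvd_conductorNorm_iff_not_hasGoodReductionAtPrime`) splits
in `K′` (Heegner), so `(d′/p) = +1` and `p ∤ d′` (`Quadratic.ncard_primesOver_eq_two_iff_legendreSym`). By §2 there are
primes `ℓ₃ ≡ −1 (mod p)` and `ℓ₁ ≡ −x (mod p)` (`x` a non-residue, `FiniteField.exists_nonsquare`), larger than `p`,
`|Δ_min(W)|` and `|Δ_min(W₁)|` (`W₁ ~ W` globally minimal with CM by the maximal order of the SAME field,
`X12.exists_isGloballyMinimal_isIsogenous_maximal_cmFieldDiscr_eq`), with `(d/ℓ) = (d/p) = −1` (inert in `K_CM`) and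
`(d′/ℓ) = (d′/p) = 1` (split in `K′`). Deuring (`X12.frobeniusTrace_eq_zero_of_legendreSym_cmFieldDiscr_eq_neg_one`
for `W₁`, isogeny invariance `frobeniusTrace_eq_of_isIsogenous`) gives `a_{ℓ₃}(W) = a_{ℓ₁}(W) = 0`, so by §3 some
`σ₃, σ₁ ∈ Γ_{K′}` act on `E_{K′}[p]` with characteristic polynomials `X² + ℓ̄₃ = X² − 1` and `X² + ℓ̄₁ = X² − x`; §1
(`isAbsolutelyIrreducible_of_charpoly`, `2 ≠ 0` in `𝔽_p` as `p ≥ 5`) concludes. The binders `W.HasCM`,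
`[NeZero (W.conductorNorm ℤ)]` and `IsTotallyComplex K′` are carried (planner's signature), not used beyond
`[K′ : ℚ] = 2`. [cite: Hsieh2014, Thm. B hypothesis (2) (Doc. Math. 19 p. 712)] [cite: Lang1987, Ch. 13 §4 Thm. 12 (PDF p. 140)]
[cite: DiamondShurman2005, Thm. 9.4.1 (proof)] [cite: DarmonDiamondTaylor1995, Thm. 3.1 (b)–(c) and p. 87]
[cite: Cox2013, §1.C Lemma 1.14] -/
theorem absIrrModPBaseChangeCMInert :
    ∀ (W : WeierstrassCurve ℚ) [W.IsElliptic] [W.IsGloballyMinimal] (p : ℕ) [Fact p.Prime]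
      [NeZero (W.conductorNorm ℤ)], W.HasCM → 5 ≤ p → CMInert W p → ¬ Good W p →
      ∀ (K : Type) [Field K] [NumberField K], IsImaginaryQuadratic K →
        SatisfiesHeegnerHypothesis (W.conductorNorm ℤ) K →
        ∀ ρ : ModPGaloisRep K (ZMod p) 2, (W.baseChange K).IsTorsionGaloisRep p ρ →
          FramedRep.IsAbsolutelyIrreducible ρ := by
  intro W _ _ p _ _ _hCM hp5 hin hbad K _ _ hK hHN ρ hρ
  have hp : p.Prime := Fact.out
  have hp2 : p ≠ 2 := by omega
  -- the CM field discriminant `d`: `p ∤ d`, `(d/p) = −1`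
  set d : ℤ := cmFieldDiscrOfJ W.j with hd
  have hpd : ¬ (p : ℤ) ∣ d := hin.1
  have hd0 : d ≠ 0 := fun h ↦ hpd (by rw [h]; exact dvd_zero _)
  have hns : ¬ IsSquare ((d : ℤ) : ZMod p) := fun hsq ↦ hin.2 ⟨hpd, by rw [if_neg hp2]; exact hsq⟩
  have hJd : J(d | p) = -1 := by
    rw [← jacobiSym.legendreSym.to_jacobiSym, legendreSym.eq_neg_one_iff]
    exact hns
  -- `p ∣ N` splits in `K`: `(d_K/p) = 1`, `p ∤ d_K`
  have hpN : p ∣ W.conductorNorm ℤ := (W.dvd_conductorNorm_iff_not_hasGoodReductionAtPrime p).mpr hbad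
  have hJK : J(NumberField.discr K | p) = 1 := by
    rw [← jacobiSym.legendreSym.to_jacobiSym]
    exact (ncard_primesOver_eq_two_iff_legendreSym hK.1 hp2).mp (hHN p hp hpN)
  have hpdK : ¬ (p : ℤ) ∣ NumberField.discr K := by
    intro h
    have h0 : legendreSym p (NumberField.discr K) = 0 :=
      (legendreSym.eq_zero_iff p _).mpr ((ZMod.intCast_zmod_eq_zero_iff_dvd _ p).mpr h)
    rw [← jacobiSym.legendreSym.to_jacobiSym, h0] at hJK
    exact zero_ne_one hJK
  have hdK0 : NumberField.discr K ≠ 0 := fun h ↦ hpdK (by rw [h]; exact dvd_zero _)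
  have hdK4 := discr_emod_four_of_finrank_eq_two hK.1
  -- the isogenous curve `W₁` with CM by the maximal order of the same field; `d ≡ 0, 1 (mod 4)`
  obtain ⟨W₁, hE₁, hmin₁, hiso, hj₁, hd₁⟩ :=
    X12.exists_isGloballyMinimal_isIsogenous_maximal_cmFieldDiscr_eq W
      (X12.mem_cmJInvariants_of_cmFieldDiscrOfJ_ne_zero hd0)
  haveI := hE₁
  haveI := hmin₁
  have hd4 : d % 4 = 0 ∨ d % 4 = 1 := by
    rw [hd, ← hd₁]
    exact cmFieldDiscr_emod_four hj₁
  -- a non-residue `x` mod `p`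
  obtain ⟨x, hx⟩ := FiniteField.exists_nonsquare (F := ZMod p) (by rw [ZMod.ringChar_zmod_n]; exact hp2)
  have hx0 : x ≠ 0 := fun h ↦ hx (by rw [h]; exact IsSquare.zero)
  -- the auxiliary primes: from `(d/ℓ) = −1`, `(d_K/ℓ) = 1`, `ℓ` large, read off `a_ℓ(W) = 0`, `ℓ` split, `ℓ` good
  set n : ℕ := max (minimalDiscriminantInt W).natAbs (minimalDiscriminantInt W₁).natAbs with hn
  have aux : ∀ {ℓ : ℕ}, ℓ.Prime → n < ℓ → p < ℓ → ¬ (ℓ : ℤ) ∣ d → J(d | ℓ) = J(d | p) →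
      J(NumberField.discr K | ℓ) = J(NumberField.discr K | p) →
      W.frobeniusTrace ℓ = 0 ∧ ((Ideal.span {(ℓ : ℤ)}).primesOver (𝓞 K)).ncard = 2 ∧
        ¬ (ℓ : ℤ) ∣ minimalDiscriminantInt W ∧ ℓ ≠ p := by
    intro ℓ hℓ hnℓ hpℓ hℓd hJℓd hJℓK
    haveI : Fact ℓ.Prime := ⟨hℓ⟩
    have hℓ2 : ℓ ≠ 2 := by omega
    rw [hn, max_lt_iff] at hnℓ
    have hℓΔ : ¬ (ℓ : ℤ) ∣ minimalDiscriminantInt W :=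
      X12.natCast_not_dvd_of_natAbs_lt (minimalDiscriminantInt_ne_zero W) hnℓ.1
    have hℓΔ₁ : ¬ (ℓ : ℤ) ∣ minimalDiscriminantInt W₁ :=
      X12.natCast_not_dvd_of_natAbs_lt (minimalDiscriminantInt_ne_zero W₁) hnℓ.2
    -- Deuring on `W₁`: `a_ℓ(W₁) = 0`
    have hℓd2 : ¬ (ℓ : ℤ) ∣ 2 * cmFieldDiscr W₁.j := by
      rw [hd₁, ← hd]
      intro h
      rcases (Nat.prime_iff_prime_int.mp hℓ).dvd_or_dvd h with h2 | h2
      · exact hℓ2 ((Nat.prime_dvd_prime_iff_eq hℓ Nat.prime_two).mp (by exact_mod_cast h2))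
      · exact hℓd h2
    have hinert : legendreSym ℓ (cmFieldDiscr W₁.j) = -1 := by
      rw [hd₁, ← hd, jacobiSym.legendreSym.to_jacobiSym, hJℓd, hJd]
    have ha₁ : W₁.frobeniusTrace ℓ = 0 :=
      X12.frobeniusTrace_eq_zero_of_legendreSym_cmFieldDiscr_eq_neg_one W₁ hj₁ ℓ hℓd2 hℓΔ₁ hinert
    have ha : W.frobeniusTrace ℓ = 0 := by
      rw [frobeniusTrace_eq_of_isIsogenous hiso ℓ (hasGoodReductionAtPrime_of_not_dvd W ℓ hℓΔ)
        (hasGoodReductionAtPrime_of_not_dvd W₁ ℓ hℓΔ₁), ha₁]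
    -- `ℓ` splits in `K`
    have hsplit : ((Ideal.span {(ℓ : ℤ)}).primesOver (𝓞 K)).ncard = 2 := by
      refine (ncard_primesOver_eq_two_iff_legendreSym hK.1 hℓ2).mpr ?_
      rw [jacobiSym.legendreSym.to_jacobiSym, hJℓK, hJK]
    exact ⟨ha, hsplit, hℓΔ, by omega⟩
  -- `ℓ₃ ≡ −1 (mod p)` and `ℓ₁ ≡ −x (mod p)`
  obtain ⟨ℓ₃, hℓ₃, hnℓ₃, hpℓ₃, hℓ₃d, -, hℓ₃c, hJ₃d, hJ₃K⟩ := exists_prime_jacobiSym_eq_jacobiSym hd0 hd4 hdK0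
    hdK4 hp hp2 hpd hpdK (c := (-1 : ZMod p)) (neg_ne_zero.mpr one_ne_zero) n
  obtain ⟨ℓ₁, hℓ₁, hnℓ₁, hpℓ₁, hℓ₁d, -, hℓ₁c, hJ₁d, hJ₁K⟩ := exists_prime_jacobiSym_eq_jacobiSym hd0 hd4 hdK0
    hdK4 hp hp2 hpd hpdK (c := -x) (neg_ne_zero.mpr hx0) n
  obtain ⟨ha₃, hsplit₃, hΔ₃, hne₃⟩ := aux hℓ₃ hnℓ₃ hpℓ₃ hℓ₃d hJ₃d hJ₃K
  obtain ⟨ha₁', hsplit₁, hΔ₁, hne₁⟩ := aux hℓ₁ hnℓ₁ hpℓ₁ hℓ₁d hJ₁d hJ₁K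
  -- the two Frobenius elements of `Γ_K`
  obtain ⟨σ₃, hσ₃⟩ := exists_charpoly_eq_of_split W p K hK.1 hρ hℓ₃ hne₃ hΔ₃ hsplit₃
  obtain ⟨σ₁, hσ₁⟩ := exists_charpoly_eq_of_split W p K hK.1 hρ hℓ₁ hne₁ hΔ₁ hsplit₁
  rw [ha₃, Int.cast_zero, hℓ₃c] at hσ₃
  rw [ha₁', Int.cast_zero, hℓ₁c] at hσ₁
  -- §1
  have h2 : (2 : ZMod p) ≠ 0 := two_ne_zero_zmod hp2
  exact isAbsolutelyIrreducible_of_charpoly ρ h2 hσ₃ hσ₁ hx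

end Summit.BirchSwinnertonDyer.BirchSwinnertonDyer.Theorems.BiquadraticEisensteinDescentEisensteinDivisibilityCMInertBadFlatAtOneAbsIrr

end
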